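import Mathlib.Analysis.Normed.Algebra.Exponential
import Mathlib.Analysis.SpecialFunctions.Trigonometric.Series
import HarnessLib

/-!
# The exponential of an element with scalar square: `e^{x} = cosh E + (sinh E / E) x` if `x² = E²`

Topic `Literature/Analysis/Matrix`. In a normed `ℂ`-algebra `𝔸` (e.g. `Matrix n n ℂ`), an
element with SCALAR SQUARE `x * x = E² • 1` (`E : ℂ`; e.g. a traceless `2 × 2` matrix, `x² = -det x`,
a Pauli/Dirac/Clifford vector, a `2 × 2` BdG symbol block `!![ξ, Δ; conj Δ, -ξ]` with
`E² = ξ² + |Δ|²`) has the closed-form exponential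

  `exp x = cosh E • 1 + (sinh E / E) • x`   (`E ≠ 0`),   `exp x = 1 + x`   (`x² = 0`):

the even terms of the exponential series are `E^{2n}/(2n)! • 1`, the odd ones `E^{2n}/(2n+1)! • x`
(same mechanism as Mathlib's `Quaternion.exp_of_re_eq_zero`, where `q² = -‖q‖²` gives `cos/sin`).
All statements PROVED; no definition.

* `pow_two_mul_of_mul_self_eq`, `pow_two_mul_add_one_of_mul_self_eq` — `x^{2n} = Eⁿ²•1`, `x^{2n+1} = E^{2n}•x`;
* `expSeries_even_of_mul_self_eq`, `expSeries_odd_of_mul_self_eq`, `hasSum_expSeries_of_mul_self_eq`;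
* **`exp_of_mul_self_eq_smul_one`** — `exp x = cosh E • 1 + (sinh E / E) • x` for `x * x = E² • 1`, `E ≠ 0`;
* `exp_of_mul_self_eq_zero` — `exp x = 1 + x` for `x * x = 0`;
* `exp_smul_of_mul_self_eq_smul_one` — the one-parameter form
  `exp (t • x) = cosh (tE) • 1 + (sinh (tE) / E) • x` (`E ≠ 0`, any `t : ℂ`, including `t = 0`).

## Mathlib search

`Quaternion.exp_of_re_eq_zero` / `hasSum_expSeries_of_imaginary` (the template), `Complex.hasSum_cosh`,
`Complex.hasSum_sinh`, `HasSum.even_add_odd`, `NormedSpace.expSeries_apply_eq`, `NormedSpace.exp_eq_tsum`;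
nothing for a general scalar square (`rg "sq_eq_smul_one|mul_self_eq_smul_one" Mathlib`: no hits).

## References

* Folklore (e.g. any quantum-mechanics text: `e^{iθ n·σ} = cos θ + i sin θ n·σ`); B. C. Hall, *Lie Groups,
  Lie Algebras, and Representations*, 2nd ed., Springer GTM 222 (2015), §2.2, Example/Exercise on
  `exp` of `2 × 2` traceless matrices. [folklore]
-/

namespace Literature.Analysis.Matrix

open NormedSpace
open scoped Nat

variable {𝔸 : Type*} [NormedRing 𝔸] [NormedAlgebra ℂ 𝔸]

/-- Even powers of an element with scalar square: `x^{2n} = (E²)ⁿ • 1`. [folklore] -/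
theorem pow_two_mul_of_mul_self_eq {x : 𝔸} {c : ℂ} (hx : x * x = c • (1 : 𝔸)) (n : ℕ) :
    x ^ (2 * n) = (c ^ n) • (1 : 𝔸) := by
  rw [pow_mul, sq, hx, smul_pow, one_pow]

/-- Odd powers of an element with scalar square: `x^{2n+1} = (E²)ⁿ • x`. [folklore] -/
theorem pow_two_mul_add_one_of_mul_self_eq {x : 𝔸} {c : ℂ} (hx : x * x = c • (1 : 𝔸)) (n : ℕ) :
    x ^ (2 * n + 1) = (c ^ n) • x := by
  rw [pow_succ, pow_two_mul_of_mul_self_eq hx, smul_mul_assoc, one_mul]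

/-- The even terms of the exponential series of `x` with `x² = E² • 1` are `E^{2n}/(2n)! • 1`.
[folklore] -/
theorem expSeries_even_of_mul_self_eq {x : 𝔸} {E : ℂ} (hx : x * x = (E ^ 2) • (1 : 𝔸)) (n : ℕ) :
    (expSeries ℂ 𝔸 (2 * n) fun _ => x) = (E ^ (2 * n) / (2 * n)!) • (1 : 𝔸) := by
  rw [expSeries_apply_eq, pow_two_mul_of_mul_self_eq hx, smul_smul, ← pow_mul, div_eq_inv_mul]

/-- The odd terms of the exponential series of `x` with `x² = E² • 1`, `E ≠ 0`, are
`(E^{2n+1}/(2n+1)!)/E • x`. [folklore] -/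
theorem expSeries_odd_of_mul_self_eq {x : 𝔸} {E : ℂ} (hx : x * x = (E ^ 2) • (1 : 𝔸)) (hE : E ≠ 0)
    (n : ℕ) :
    (expSeries ℂ 𝔸 (2 * n + 1) fun _ => x) = (E ^ (2 * n + 1) / (2 * n + 1)! / E) • x := by
  rw [expSeries_apply_eq, pow_two_mul_add_one_of_mul_self_eq hx, smul_smul, ← pow_mul]
  congr 1
  rw [pow_succ, div_div, mul_comm ((2 * n + 1)! : ℂ) E, ← div_div, mul_div_cancel_right₀ _ hE,
    div_eq_inv_mul]

/-- The exponential series of `x` with `x² = E² • 1` (`E ≠ 0`) sums to `cosh E • 1 + (sinh E / E) • x`.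
[folklore] -/
theorem hasSum_expSeries_of_mul_self_eq {x : 𝔸} {E : ℂ} (hx : x * x = (E ^ 2) • (1 : 𝔸))
    (hE : E ≠ 0) :
    HasSum (fun n => expSeries ℂ 𝔸 n fun _ => x)
      (Complex.cosh E • (1 : 𝔸) + (Complex.sinh E / E) • x) := by
  have hc := (Complex.hasSum_cosh E).smul_const (1 : 𝔸)
  have hs := ((Complex.hasSum_sinh E).div_const E).smul_const x
  refine HasSum.even_add_odd ?_ ?_
  · convert hc using 1
    ext n : 1
    rw [expSeries_even_of_mul_self_eq hx]
  · convert hs using 1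
    ext n : 1
    rw [expSeries_odd_of_mul_self_eq hx hE]

/-- **The exponential of an element with scalar square**: if `x * x = E² • 1` with `E ≠ 0`, then
`exp x = cosh E • 1 + (sinh E / E) • x`. [folklore] -/
theorem exp_of_mul_self_eq_smul_one {x : 𝔸} {E : ℂ} (hx : x * x = (E ^ 2) • (1 : 𝔸)) (hE : E ≠ 0) :
    exp x = Complex.cosh E • (1 : 𝔸) + (Complex.sinh E / E) • x := by
  rw [exp_eq_tsum ℂ]
  refine HasSum.tsum_eq ?_
  simp_rw [← expSeries_apply_eq]
  exact hasSum_expSeries_of_mul_self_eq hx hE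

/-- The nilpotent case: `x * x = 0` gives `exp x = 1 + x`. [folklore] -/
theorem exp_of_mul_self_eq_zero {x : 𝔸} (hx : x * x = 0) : exp x = 1 + x := by
  rw [exp_eq_tsum ℂ]
  have h : HasSum (fun n : ℕ => (n !⁻¹ : ℂ) • x ^ n) (1 + x) := by
    have hzero : ∀ n ∉ ({0, 1} : Finset ℕ), (n !⁻¹ : ℂ) • x ^ n = 0 := by
      intro n hn
      simp only [Finset.mem_insert, Finset.mem_singleton, not_or] at hn
      obtain ⟨k, rfl⟩ : ∃ k, n = k + 2 := ⟨n - 2, by omega⟩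
      rw [pow_add, sq, hx, mul_zero, smul_zero]
    have h : HasSum (fun n : ℕ => (n !⁻¹ : ℂ) • x ^ n)
        (∑ n ∈ ({0, 1} : Finset ℕ), (n !⁻¹ : ℂ) • x ^ n) := hasSum_sum_of_ne_finset_zero hzero
    rwa [Finset.sum_insert (by simp), Finset.sum_singleton, pow_zero, pow_one, Nat.factorial_zero,
      Nat.factorial_one, Nat.cast_one, inv_one, one_smul, one_smul] at h
  exact h.tsum_eq

/-- **One-parameter form**: if `x * x = E² • 1` with `E ≠ 0` then for every `t : ℂ`,
`exp (t • x) = cosh (tE) • 1 + (sinh (tE) / E) • x` (at `t = 0` both sides are `1`). [folklore] -/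
theorem exp_smul_of_mul_self_eq_smul_one {x : 𝔸} {E : ℂ} (hx : x * x = (E ^ 2) • (1 : 𝔸))
    (hE : E ≠ 0) (t : ℂ) :
    exp (t • x) = Complex.cosh (t * E) • (1 : 𝔸) + (Complex.sinh (t * E) / E) • x := by
  by_cases ht : t = 0
  · subst ht
    rw [zero_smul, exp_zero, zero_mul, Complex.cosh_zero, Complex.sinh_zero, zero_div, one_smul,
      zero_smul, add_zero]
  · have htx : (t • x) * (t • x) = ((t * E) ^ 2) • (1 : 𝔸) := by
      rw [smul_mul_smul_comm, hx, smul_smul, mul_pow, sq t]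
    rw [exp_of_mul_self_eq_smul_one htx (mul_ne_zero ht hE), smul_smul]
    congr 2
    field_simp

end Literature.Analysis.Matrix
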